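import Literature.MathematicalPhysics.QuantumFieldTheory.Balaban1983to89.B8Prop6CubeMemberOfPrinted
import Literature.MathematicalPhysics.QuantumFieldTheory.Balaban1983to89.B8Prop6CubeMemberNormsBdry
import Literature.MathematicalPhysics.QuantumFieldTheory.Balaban1983to89.B8LeafModelZd3Bdry

/-!
# `Balaban1983to89.B8Prop6CubeMemberGaugedBdry` — [Balaban1985RegularSpaces] PROPOSITION 6 (p. 99) (1.135)–(1.138) AT THE CONCRETE CUBE
# MEMBER AS `Node00.GaugedBoundB8` ∕ `B8.Prop6Printed` ON `Node00.zdCub`, FROM THE SOCKETS IN THE REPAIRED CURRENCY — the non-vacuous twin of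
# this seat's g0 `B8Prop6CubeMemberGauged.prop6Printed_zdCub₃`

statement-level skeleton of published theorems with citation tags; proofs where landed; nothing here is a claim about the
Yang–Mills mass gap

PDF held: `paper:balaban1985-cmp99-regular-spaces-gauge-fixing` (journal page = PDF page + 74); pp. 86–88, 94, 98–99.

CITATION HEADER (lean-in-tree rule).  Cell `pub-ymgap` (YM Track A, HUMAN RULING D-0062), DAG node N05 = [B8], seat `pub-ymgap-dag-n05-e`
(R141 (C) fan-out, row s3b), generation g6 — the closing module of the located repair R-d at the cube member.  WHY: every earlier `p6`
provider of the cube line (`prop6Printed_zdCub₃`, `…_flat₃`, `…_real₃`, n05-c's `prop6_exists_cubeMember[_of_HFP₄]`) keys the (1.59) sockets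
`SockH59`∕`SockB9P3` at the cube member, certified FALSE there (this seat's g5).  THIS FILE: Proposition 6 at every cube (as `GaugedBoundB8`,
as `B8.Prop6Printed` on `zdCub ∘ f`, and on NODE 00's member of record) from (i) Theorem 4 AS PRINTED on the cube sub-family — itself provided by
`B8LeafModelZd3Bdry.thm4Printed_zd3_map_bdry` from `SockP5base`∕`SockP5`∕`SockP5u` and the REPAIRED (1.59) socket — and (ii) the Prop.-3-frame
b9 socket at the cube IN THE REPAIRED CURRENCY (`B8Prop6CubeMemberNormsBdry`).  §2 packages the five per-cube socket binders.  Kind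
«kernel-checked proof», theorems only, no `def`.

HONEST SCOPE.  (i) By-name composition; the sockets (Prop. 5 ∃ base∕step∕uniqueness; [4] Thm 3.3 for `G(U₀)` in Theorem 4's frame and for
`G(1)`, `H(1)` in Proposition 3's frame, both WITH exterior data) are HYPOTHESES at print's finite cube families — none certified false, none
discharged; their providers are N06's junction in the repaired currency (flat background, finite cube, Dirichlet data).  (ii) `B_∂` and
`4B_∂ ≤ (dL − 1)B₀` are the tree's bookkeeping of exterior data (print keeps them inside (1.58)).  (iii) As in `B8Prop6CubeMemberGauged`:
uniqueness of `u`, (1.137)'s inequalities and the Hölder member are not folded into `GaugedBoundB8`.  Count-neutral; N05 NOT discharged; one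
finite `𝕋⁴` programme at fixed `ε`, Bałaban as printed; nothing continuum ∕ ℝ⁴ ∕ OS ∕ mass-gap ∕ Clay.  Unit `pub-ymgap-dag-n05-e` (g6), 2026-08-27.
-/

noncomputable section

open NormedSpace

namespace Literature.MathematicalPhysics.QuantumFieldTheory.Balaban1983to89.B8Prop6CubeMemberGaugedBdry

open MatrixLog B7Prop1Explicit B7Prop2Explicit B7Prop1Local B7Eq92Concrete
open B7Prop3Flat (c3)
open B7Prop4GeneralLevels (logCovIter linCovIter)
open B8Ineq132 (InAk inAk_gaugeAct_iff pdevOn_lt_of_inAk covDerivFwd BondTouches)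
open B8Ineq133 (cutFixed)
open B8Eq115GaugeFixing (localGauge gaugeAct_mem_of)
open B8Eq119TwistedAxial (Restr129 InAx)
open B8Eq140Level (SideTouches)
open B8Eq146AExpansion (iEta plaqCovDeriv)
open B8Eq143PlaqExpansion (pdiv)
open B8Eq155JBound (Jcur wsup)
open B8ScaledSupNorm (bondNorm msup)
open B8Eq184Proof (cfgExp)
open B8Eq138LandauZd (IsLandau138W logCfg covLap)
open B8Eq131Cubes (tcube tLo tHi ctr tLo_le_tHi)
open B8Eq131CubesAdmissible (cubeFam)
open B8CubeMemberZd (cubeLamS cubeLamB hΩ_cubeFam hbox_cubeLamB hclass_cubeLamB htower_cubeLam hpart_cubeLam)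
open B8Prop6CubeMember (thm4_hypotheses_one_cutFixed)
open B8Lemma1NonAbelian (mulCfg)
open B8Prop6OfThm4 (const_136 smallness_134 localGauge_mem agree135)
open B8LeafModelZd (ZdIdx SockP5base SockP5 SockP5u)
open B8LeafModelZd3 (mlogCfg zdGF3)
open B9Eq340HolderZd (hquot AdmPair)
open B8Prop6CubeMemberNormsAt (windows136_of_small)
open B8Prop6CubeMemberGauged (gaugedBoundB8_of_clauses)
open B8Prop3GaugeFixedKLevel (mem_unitaryUnits_of_mgauge_eq)
open B8Thm4AtLandau138 (mgauge_mgauge_inv)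
open Node00 (CubeB8 GaugedBoundB8 zdCub prop6Printed_zdCub_iff)

-- `Site` alone could resolve to the torus sites of `Setup.lean`; re-export the `ℤ^d` sites of `B7Prop1Explicit`.
export B7Prop1Explicit (Site)

variable {d : ℕ}

variable {𝔸 : Type} [CStarAlgebra 𝔸] [Nontrivial 𝔸]

/-! ## §1 (1.135)–(1.138) at every cube from Theorem 4 as printed on the cube sub-family + the repaired b9 socket at the cube -/

/-- **PROPOSITION 6 (p. 99), (1.135)–(1.138) AS `Node00.GaugedBoundB8` AT EVERY CUBE, FROM THEOREM 4 AS PRINTED ON THE CUBE SUB-FAMILY AND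
THE PROP.-3-FRAME b9 SOCKET AT THE CUBE IN THE REPAIRED CURRENCY** — `B8Prop6CubeMemberOfPrinted.gaugedBoundB8_cubeMember_of_printed` with its
Proposition-3 binder `H3c` SERVED: the gradient ∕ `∂*∂` ∕ `Δ` members come from `B8Prop6CubeMemberNormsBdry.norms136_cubeMember_at_bdry`, i.e.
from [4] Thm 3.3 for `G(1)`, `H(1)` on the finite cube family WITH exterior data (the socket stated inline at the cube; constants `inp.B₀`,
`B₀β`, `cB9`, `Bbd`, side condition `4B_∂ ≤ (dL − 1)·inp.B₀`).  Theorem 4 enters as the printed sentence on the cube sub-family (`H4`;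
its provider in the repaired currency is `B8LeafModelZd3Bdry.thm4Printed_zd3_map_bdry`).
[cite: Balaban1985RegularSpaces, Prop. 6 (1.135)–(1.138) p.99, Thm 4 p.88, Prop. 3 p.87, (1.58)–(1.59) p.86] -/
theorem gaugedBoundB8_cubeMember_of_thm4_b9D (hd2 : 2 ≤ d) {L : ℕ} (hL : 2 ≤ L) (inp : B8.B9Inputs) {B₀β C₂ cB9 Bbd : ℝ}
    (hC₂ : 2097152 * ((d : ℝ) + 1) ^ 2 ≤ C₂) (hcB9 : 0 < cB9) (hBbd : 0 ≤ Bbd) (hBd : 4 * Bbd ≤ ((d : ℝ) * L - 1) * inp.B₀)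
    (β : ℝ) (len : Site d → ℝ)
    (H4 : B8.Thm4Printed (5 * (d : ℝ) * L * inp.B₀)
      (fun i : {i : ZdIdx d L // ∃ (a : Site d) (M ρ : ℕ), L ≤ ρ ∧ ρ ≤ M ∧ 11 * d < M ∧ L ≤ d * M ∧
        i.Ω = cubeFam false L a M ρ i.k ∧ i.Λs = cubeLamS L a M ρ i.k ∧ i.Λb = cubeLamB L a M ρ i.k} => (zdGF3 𝔸 L β len i.1).toGFData)) :
    ∃ c₁ : ℝ, 0 < c₁ ∧ ∀ (η : ℝ), 0 < η → ∀ {K : ℕ} {Ω : ℕ → Set (Site d)} (c : CubeB8 d L K Ω),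
      -- the Prop.-3-frame b9 socket AT THE CUBE, IN THE REPAIRED CURRENCY (constants `inp.B₀`, `B₀β`, `cB9`, `Bbd`)
      (∀ α₀ α₂ : ℝ, 0 < α₀ → α₀ ≤ cB9 → 0 < α₂ → α₂ ≤ cB9 →
      ∀ (U₀ W : Site d → Fin d → 𝔸ˣ), (∀ x κ, U₀ x κ ∈ unitaryUnits 𝔸) → (∀ x κ, W x κ ∈ unitaryUnits 𝔸) →
      InAk L c.k η α₀ (cubeFam false L c.a c.M c.ρ c.k) U₀ → InAk L c.k η α₀ (cubeFam false L c.a c.M c.ρ c.k) (mulCfg W U₀) → IsLandau138W L c.k η ((cubeFam false L c.a c.M c.ρ c.k) 0) (cubeLamS L c.a c.M c.ρ c.k c.k) U₀ W →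
      ∀ A' : Site d → Fin d → 𝔸, (∀ y τ, IsSelfAdjoint (A' y τ)) →
      (∀ j, j ≤ c.k → ∀ (y : Site d) (τ : Fin d), SideTouches ((cubeFam false L c.a c.M c.ρ c.k) j) y τ →
      W y τ = cfgExp η A' y τ ∧ ‖A' y τ‖ ≤ α₂ * ((L : ℝ) ^ j * η)⁻¹) →
      (∀ (y : Site d) (τ : Fin d), (∀ j, j ≤ c.k → ¬ SideTouches ((cubeFam false L c.a c.M c.ρ c.k) j) y τ) → A' y τ = 0) →
      msup L c.k η (-(1 : ℝ)) (fun j (b : Site d × Fin d) => SideTouches ((cubeFam false L c.a c.M c.ρ c.k) j) b.1 b.2) (fun b => A' b.1 b.2)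
      ≤ inp.B₀ * (bondNorm L c.k η (-(3 : ℝ)) (cubeFam false L c.a c.M c.ρ c.k) (fun x μ => Jcur η U₀ A' μ x)
      + wsup 1 (fun p : {p : ℕ × (Site d × Fin d) // p.1 ≤ c.k ∧ p.2 ∈ cubeLamB L c.a c.M c.ρ c.k c.k p.1} =>
      linCovIter L U₀ (iEta η A') p.1.1 p.1.2.1 p.1.2.2)) + Bbd * msup L c.k η (-(1 : ℝ))
      (fun j (b : Site d × Fin d) => j = 0 ∧ SideTouches ((cubeFam false L c.a c.M c.ρ c.k) 0) b.1 b.2 ∧ ¬ BondTouches ((cubeFam false L c.a c.M c.ρ c.k) 0) b.1 b.2)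
      (fun b => A' b.1 b.2) ∧
      msup L c.k η (-(2 : ℝ)) (fun j (t : Fin d × Fin d × Site d) => SideTouches ((cubeFam false L c.a c.M c.ρ c.k) j) t.2.2 t.2.1)
      (fun t => covDerivFwd η U₀ t.1 (fun z => A' z t.2.1) t.2.2)
      ≤ inp.B₀ * (bondNorm L c.k η (-(3 : ℝ)) (cubeFam false L c.a c.M c.ρ c.k) (fun x μ => Jcur η U₀ A' μ x)
      + wsup 1 (fun p : {p : ℕ × (Site d × Fin d) // p.1 ≤ c.k ∧ p.2 ∈ cubeLamB L c.a c.M c.ρ c.k c.k p.1} =>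
      linCovIter L U₀ (iEta η A') p.1.1 p.1.2.1 p.1.2.2)) + Bbd * msup L c.k η (-(1 : ℝ))
      (fun j (b : Site d × Fin d) => j = 0 ∧ SideTouches ((cubeFam false L c.a c.M c.ρ c.k) 0) b.1 b.2 ∧ ¬ BondTouches ((cubeFam false L c.a c.M c.ρ c.k) 0) b.1 b.2)
      (fun b => A' b.1 b.2) ∧
      bondNorm L c.k η (-(3 : ℝ)) (cubeFam false L c.a c.M c.ρ c.k) (fun x μ => pdiv η U₀ (plaqCovDeriv η U₀ A') μ x)
      ≤ inp.B₀ * (bondNorm L c.k η (-(3 : ℝ)) (cubeFam false L c.a c.M c.ρ c.k) (fun x μ => Jcur η U₀ A' μ x)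
      + wsup 1 (fun p : {p : ℕ × (Site d × Fin d) // p.1 ≤ c.k ∧ p.2 ∈ cubeLamB L c.a c.M c.ρ c.k c.k p.1} =>
      linCovIter L U₀ (iEta η A') p.1.1 p.1.2.1 p.1.2.2)) + Bbd * msup L c.k η (-(1 : ℝ))
      (fun j (b : Site d × Fin d) => j = 0 ∧ SideTouches ((cubeFam false L c.a c.M c.ρ c.k) 0) b.1 b.2 ∧ ¬ BondTouches ((cubeFam false L c.a c.M c.ρ c.k) 0) b.1 b.2)
      (fun b => A' b.1 b.2) ∧
      bondNorm L c.k η (-(3 : ℝ)) (cubeFam false L c.a c.M c.ρ c.k) (fun x μ => covLap η U₀ (fun z => A' z μ) x)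
      ≤ inp.B₀ * (bondNorm L c.k η (-(3 : ℝ)) (cubeFam false L c.a c.M c.ρ c.k) (fun x μ => Jcur η U₀ A' μ x)
      + wsup 1 (fun p : {p : ℕ × (Site d × Fin d) // p.1 ≤ c.k ∧ p.2 ∈ cubeLamB L c.a c.M c.ρ c.k c.k p.1} =>
      linCovIter L U₀ (iEta η A') p.1.1 p.1.2.1 p.1.2.2)) + Bbd * msup L c.k η (-(1 : ℝ))
      (fun j (b : Site d × Fin d) => j = 0 ∧ SideTouches ((cubeFam false L c.a c.M c.ρ c.k) 0) b.1 b.2 ∧ ¬ BondTouches ((cubeFam false L c.a c.M c.ρ c.k) 0) b.1 b.2)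
      (fun b => A' b.1 b.2) ∧
      msup L c.k η (-(2 + β)) (fun j (q : Fin d × Fin d × (Site d × Site d)) => q.2.2 ∈ AdmPair η len ∧ q.2.2.1 ∈ (cubeFam false L c.a c.M c.ρ c.k) j)
      (fun q => hquot η β len U₀ (covDerivFwd η U₀ q.1 (fun z => A' z q.2.1)) q.2.2)
      ≤ B₀β * (bondNorm L c.k η (-(3 : ℝ)) (cubeFam false L c.a c.M c.ρ c.k) (fun x μ => Jcur η U₀ A' μ x)
      + wsup 1 (fun p : {p : ℕ × (Site d × Fin d) // p.1 ≤ c.k ∧ p.2 ∈ cubeLamB L c.a c.M c.ρ c.k c.k p.1} =>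
      linCovIter L U₀ (iEta η A') p.1.1 p.1.2.1 p.1.2.2)) + Bbd * msup L c.k η (-(1 : ℝ))
      (fun j (b : Site d × Fin d) => j = 0 ∧ SideTouches ((cubeFam false L c.a c.M c.ρ c.k) 0) b.1 b.2 ∧ ¬ BondTouches ((cubeFam false L c.a c.M c.ρ c.k) 0) b.1 b.2)
      (fun b => A' b.1 b.2)) →
      ∀ (U₀ : Site d → Fin d → 𝔸ˣ), (∀ x κ, U₀ x κ ∈ unitaryUnits 𝔸) → ∀ (α₀ : ℝ), 0 < α₀ → InAk L K η α₀ Ω U₀ →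
      7 * d * (L : ℝ) ^ 2 * c.M * α₀ ≤ c₁ →
      GaugedBoundB8 L η U₀ c (7 * d * (L : ℝ) ^ 2 * (5 * (d : ℝ) * L * inp.B₀) * c.M * α₀) := by
  have hL1 : 1 ≤ L := le_trans (by norm_num) hL
  have hd1 : 1 ≤ d := le_trans (by norm_num) hd2
  have hLpos : (0 : ℝ) < L := by exact_mod_cast hL1
  have hdpos : (0 : ℝ) < d := by exact_mod_cast hd1
  have hB₀ : 0 < inp.B₀ := inp.B₀_pos
  obtain ⟨c₄, hc₄, T4⟩ := H4
  obtain ⟨c₃, hc₃, N3⟩ := B8Prop6CubeMemberNormsBdry.norms136_cubeMember_at_bdry (𝔸 := 𝔸) hd2 hL hB₀ hC₂ hcB9 hBbd hBd β len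
  have hC₂0 : 0 ≤ C₂ := le_trans (by positivity) hC₂
  obtain ⟨cW, hcW, W⟩ := windows136_of_small hd2 hL hB₀ hC₂0 hc₃
  set B : ℝ := 5 * (d : ℝ) * L * inp.B₀ with hB_def
  have hB0 : 0 < B := by positivity
  set C : ℝ := 131072 * ((d : ℝ) + 1) ^ 2 with hC_def
  have hC0 : 0 < C := by positivity
  refine ⟨min c₄ (min cW (1 / (16 * C * B))), lt_min hc₄ (lt_min hcW (by positivity)), ?_⟩
  intro η hη K Ω c SB9D U₀ hU₀ α₀ hα hAK hs
  -- the cube's laws as datum binders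
  have hk : 1 ≤ c.k := c.one_le_k
  have hρL : L ≤ c.ρ := c.L_le_ρ
  have hρM : c.ρ ≤ c.M := c.ρ_le_M
  have hρ : 1 ≤ c.ρ := hL1.trans hρL
  have hM1 : 1 ≤ c.M := hρ.trans hρM
  have hM : 11 * (d : ℝ) < c.M := by exact_mod_cast c.big
  have hLdM : (L : ℝ) ≤ d * c.M := by exact_mod_cast c.L_le_dM
  have hA : InAk L c.k η α₀ Ω U₀ := c.inAk hAK
  have hs₄ : 7 * d * (L : ℝ) ^ 2 * c.M * α₀ ≤ c₄ := hs.trans (min_le_left _ _)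
  have hsW : 7 * d * (L : ℝ) ^ 2 * c.M * α₀ ≤ cW := hs.trans ((min_le_right _ _).trans (min_le_left _ _))
  have hsC : 7 * d * (L : ℝ) ^ 2 * c.M * α₀ ≤ 1 / (16 * C * B) := hs.trans ((min_le_right _ _).trans (min_le_right _ _))
  -- every window from «7dL²Mα₀ ≤ c₁»
  obtain ⟨⟨hα3, hα2, hsmall⟩, ⟨hα₀c, hα₁c, hα₂c⟩, h61, ⟨-, -, h16, -, hc3α, hsmall₁⟩, h12⟩ := W c.M c.ρ hM1 hρM hM hLdM α₀ hα hsW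
  -- the shifted smallness pair `(α₀′, α₁′) = (L³α₀, 6dL²Mα₀)` and `t = α₀′ + α₁′`
  have hα₀' : 0 < (L : ℝ) ^ 3 * α₀ := by positivity
  have hMpos : (0 : ℝ) < c.M := by exact_mod_cast hM1
  have hα₁' : 0 < 6 * d * (L : ℝ) ^ 2 * c.M * α₀ := by positivity
  have ht₄ : (L : ℝ) ^ 3 * α₀ + 6 * d * (L : ℝ) ^ 2 * c.M * α₀ ≤ c₄ := smallness_134 hLpos hα hLdM hs₄
  have htpos : 0 < (L : ℝ) ^ 3 * α₀ + 6 * d * (L : ℝ) ^ 2 * c.M * α₀ := add_pos hα₀' hα₁'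
  have hα₂pos : 0 < B * ((L : ℝ) ^ 3 * α₀ + 6 * d * (L : ℝ) ^ 2 * c.M * α₀) := mul_pos hB0 htpos
  -- «the assumptions of Theorem 4 are satisfied for the pair 1, U₀″» (n05-c)
  obtain ⟨hmem, h33, h34, hAx, h135b, h66⟩ :=
    thm4_hypotheses_one_cutFixed L hL hd1 c.k U₀ hU₀ hα hα3 hα2 c.a hρ hρM hM hη hA c.tcube_sub hsmall
  set U'' := cutFixed L (tLo c.a c.ρ) (tHi c.a c.M c.ρ) U₀ c.k (ctr c.a c.M) with hU''
  have hone : ∀ x κ, (1 : Site d → Fin d → 𝔸ˣ) x κ ∈ unitaryUnits 𝔸 := fun _ _ => (unitaryUnits 𝔸).one_mem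
  -- the member `{□_j}` of the cube sub-family
  set ic : ZdIdx d L := ⟨η, hη, c.k, hk, cubeFam false L c.a c.M c.ρ c.k, hΩ_cubeFam hL1 c.a c.M hρL c.k, cubeLamS L c.a c.M c.ρ c.k,
    cubeLamB L c.a c.M c.ρ c.k, hbox_cubeLamB L c.a c.M c.ρ c.k, hclass_cubeLamB L c.a c.M c.ρ c.k, htower_cubeLam hL1 c.a c.M c.ρ c.k,
    hpart_cubeLam hL1 c.a c.M c.ρ c.k⟩ with hic_def
  have hic : ∃ (a : Site d) (M ρ : ℕ), L ≤ ρ ∧ ρ ≤ M ∧ 11 * d < M ∧ L ≤ d * M ∧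
      ic.Ω = cubeFam false L a M ρ ic.k ∧ ic.Λs = cubeLamS L a M ρ ic.k ∧ ic.Λb = cubeLamB L a M ρ ic.k :=
    ⟨c.a, c.M, c.ρ, hρL, hρM, c.big, c.L_le_dM, rfl, rfl, rfl⟩
  -- THEOREM 4 at the member, for the datum `(1, U₀″)` at `(α₀′, α₁′)`
  obtain ⟨u, hR, ⟨h137, hLan, h162⟩, -⟩ :=
    T4 ⟨ic, hic⟩ ((L : ℝ) ^ 3 * α₀) (6 * d * (L : ℝ) ^ 2 * c.M * α₀) hα₀' hα₁' ht₄ ⟨1, hone⟩ (⟨1, hone⟩, ⟨U'', hmem⟩) h33 trivial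
      ⟨rfl, h34, hAx⟩ ⟨h135b, h66⟩
  have hu : ∀ x, u.1 x ∈ unitaryUnits 𝔸 := u.2.1
  have huS : ∀ x, x ∉ cubeFam false L c.a c.M c.ρ c.k 0 → u.1 x = 1 := u.2.2
  have h129 : Restr129 L c.k (cubeLamS L c.a c.M c.ρ c.k c.k) (1 : Site d → Fin d → 𝔸ˣ) u.1 := hR
  -- the gauge-fixed field `U₁ = U₀″^{u⁻¹}` (at background `1` the moving-frame action is the ordinary gauge action)
  have hW : mgauge (1 : Site d → Fin d → 𝔸ˣ) u.1 (mgauge (1 : Site d → Fin d → 𝔸ˣ) u.1⁻¹ U'') = U'' := mgauge_mgauge_inv _ U'' u.1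
  have hWu : ∀ x κ, mgauge (1 : Site d → Fin d → 𝔸ˣ) u.1⁻¹ U'' x κ ∈ unitaryUnits 𝔸 := mem_unitaryUnits_of_mgauge_eq hone hmem hu hW
  have hLan' : IsLandau138W L c.k η (cubeFam false L c.a c.M c.ρ c.k 0) (cubeLamS L c.a c.M c.ρ c.k c.k) (1 : Site d → Fin d → 𝔸ˣ)
      (gaugeAct u.1⁻¹ U'') := by
    have h := hLan
    simp only [zdGF3, mgauge_one_left] at h
    exact h
  have h162' : ∀ j, j ≤ c.k → ∀ b ∈ {b : Site d × Fin d | SideTouches (cubeFam false L c.a c.M c.ρ c.k j) b.1 b.2},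
      gaugeAct u.1⁻¹ U'' b.1 b.2 = cfgExp η (logCfg η (gaugeAct u.1⁻¹ U'')) b.1 b.2 ∧
        IsSelfAdjoint (logCfg η (gaugeAct u.1⁻¹ U'') b.1 b.2) ∧
        ‖logCfg η (gaugeAct u.1⁻¹ U'') b.1 b.2‖ ≤
          (5 * (d : ℝ) * L * inp.B₀ * ((L : ℝ) ^ 3 * α₀ + 6 * d * (L : ℝ) ^ 2 * c.M * α₀)) * ((L : ℝ) ^ j * η)⁻¹ := by
    have h := h162
    simp only [zdGF3, mgauge_one_left] at h
    exact h
  -- PROPOSITION 3's norm members at the member FROM THE REPAIRED b9 SOCKET AT THE CUBE (this seat's `B8Prop6CubeMemberNormsBdry`)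
  obtain ⟨h136g, h139j, h139l⟩ := N3 η hη c.k hk c.a c.M c.ρ hρL hρM hM SB9D U₀ hU₀ α₀ hα hα3 hα2 Ω hA c.tcube_sub hsmall hα₀c hα₂c
    h61 hsmall₁ u.1 hu huS h129 hLan' h162'
  -- the three norm members of (1.136), with print's constant (`const_136`)
  have hconst : B * ((L : ℝ) ^ 3 * α₀ + 6 * d * (L : ℝ) ^ 2 * c.M * α₀) ≤ 7 * d * (L : ℝ) ^ 2 * B * c.M * α₀ :=
    const_136 hLpos hα hB0.le hLdM
  have h136₂ : B8ScaledSupNorm.msup L c.k η (-(2 : ℝ)) (fun j (t : Fin d × Fin d × Site d) => SideTouches (cubeFam false L c.a c.M c.ρ c.k j) t.2.2 t.2.1)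
      (fun t => B8Ineq132.covDerivFwd η (1 : Site d → Fin d → 𝔸ˣ) t.1
        (fun z => mlogCfg c.k η (cubeFam false L c.a c.M c.ρ c.k) (gaugeAct u.1⁻¹ U'') z t.2.1) t.2.2) ≤
      7 * d * (L : ℝ) ^ 2 * (5 * (d : ℝ) * L * inp.B₀) * c.M * α₀ := by
    exact h136g.trans hconst
  have h136₃ : B8ScaledSupNorm.bondNorm L c.k η (-(3 : ℝ)) (cubeFam false L c.a c.M c.ρ c.k)
      (fun x μ => B8Eq143PlaqExpansion.pdiv η (1 : Site d → Fin d → 𝔸ˣ) (B8Eq146AExpansion.plaqCovDeriv η (1 : Site d → Fin d → 𝔸ˣ)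
        (mlogCfg c.k η (cubeFam false L c.a c.M c.ρ c.k) (gaugeAct u.1⁻¹ U''))) μ x) ≤
      7 * d * (L : ℝ) ^ 2 * (5 * (d : ℝ) * L * inp.B₀) * c.M * α₀ := by
    exact h139j.trans hconst
  have h136₄ : B8ScaledSupNorm.bondNorm L c.k η (-(3 : ℝ)) (cubeFam false L c.a c.M c.ρ c.k)
      (fun x μ => B8Eq138LandauZd.covLap η (1 : Site d → Fin d → 𝔸ˣ)
        (fun z => mlogCfg c.k η (cubeFam false L c.a c.M c.ρ c.k) (gaugeAct u.1⁻¹ U'') z μ) x) ≤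
      7 * d * (L : ℝ) ^ 2 * (5 * (d : ℝ) * L * inp.B₀) * c.M * α₀ := by
    exact h139l.trans hconst
  -- (1.135): `w = v⁻¹u` is unitary and `U₀^{w⁻¹} = U₁` on `□̃`
  have hΩ' : ∃ l, l ≤ c.k ∧ c.k ≤ l + 1 ∧ ∀ x, InBox (B8Ineq130.tlo L (tLo c.a c.ρ) c.k) (B8Ineq130.thi L (tHi c.a c.M c.ρ) c.k) x → x ∈ Ω l :=
    ⟨c.k - 1, Nat.sub_le _ _, by omega, fun x hx => c.tcube_sub hx⟩
  have hvG : ∀ x, localGauge L (tLo c.a c.ρ) (tHi c.a c.M c.ρ) U₀ c.k (ctr c.a c.M) x ∈ unitaryUnits 𝔸 :=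
    localGauge_mem L hL (avgClosed_unitaryUnits (𝔸 := 𝔸) d L) c.k U₀ hU₀ hα hα3 hα2 (tLo_le_tHi hM1)
      (pdevOn_lt_of_inAk hL1 hα hA hΩ') (ctr c.a c.M)
  have hw : ∀ x, ((localGauge L (tLo c.a c.ρ) (tHi c.a c.M c.ρ) U₀ c.k (ctr c.a c.M))⁻¹ * u.1) x ∈ unitaryUnits 𝔸 := fun x =>
    (unitaryUnits 𝔸).mul_mem ((unitaryUnits 𝔸).inv_mem (hvG x)) (hu x)
  have h135 := agree135 (B8Ineq130.tlo L (tLo c.a c.ρ) c.k) (B8Ineq130.thi L (tHi c.a c.M c.ρ) c.k) U₀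
    (localGauge L (tLo c.a c.ρ) (tHi c.a c.M c.ρ) U₀ c.k (ctr c.a c.M)) u.1
  -- the [3]-Prop.-4 window of the engine
  have h16C : 16 * (131072 * ((d : ℝ) + 1) ^ 2) * (B * ((L : ℝ) ^ 3 * α₀ + 6 * d * (L : ℝ) ^ 2 * c.M * α₀)) ≤ 1 := by
    have e2 : 7 * d * (L : ℝ) ^ 2 * B * c.M * α₀ = B * (7 * d * (L : ℝ) ^ 2 * c.M * α₀) := by ring
    have e3 : B * (7 * d * (L : ℝ) ^ 2 * c.M * α₀) ≤ B * (1 / (16 * C * B)) := mul_le_mul_of_nonneg_left hsC hB0.le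
    have e4 : B * (1 / (16 * C * B)) = 1 / (16 * C) := by field_simp
    have e5 : B * ((L : ℝ) ^ 3 * α₀ + 6 * d * (L : ℝ) ^ 2 * c.M * α₀) ≤ 1 / (16 * C) := by linarith [hconst, e3]
    calc 16 * (131072 * ((d : ℝ) + 1) ^ 2) * (B * ((L : ℝ) ^ 3 * α₀ + 6 * d * (L : ℝ) ^ 2 * c.M * α₀))
        ≤ 16 * C * (1 / (16 * C)) := mul_le_mul_of_nonneg_left e5 (by positivity)
      _ = 1 := by field_simp
  exact gaugedBoundB8_of_clauses hd2 hL hB₀ hη c U₀ hU₀ hα hA hα3 hα2 hsmall h12 h16C hc3α u.1 hu huS h129 hLan' h162' hw h135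
    h136₂ h136₃ h136₄


#print axioms gaugedBoundB8_cubeMember_of_thm4_b9D

/-! ## §2 `B8.Prop6Printed` on `zdCub` and on the member of record; the five per-member socket binders packaged -/

/-- **`B8.Prop6Printed d L (5dL·inp.B₀) c₁` ON `Node00.zdCub`, FROM THEOREM 4 AS PRINTED ON THE CUBE SUB-FAMILY AND THE REPAIRED Prop.-3-FRAME b9
SOCKET AT EVERY CUBE** (`gaugedBoundB8_cubeMember_of_thm4_b9D` through `Node00.prop6Printed_zdCub_iff`).
[cite: Balaban1985RegularSpaces, Prop. 6 p.99, Thm 4 p.88, Prop. 3 p.87, (1.59) p.86] -/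
theorem prop6Printed_zdCub_of_thm4_b9D (hd2 : 2 ≤ d) {L : ℕ} (hL : 2 ≤ L) (inp : B8.B9Inputs) {B₀β C₂ cB9 Bbd : ℝ}
    (hC₂ : 2097152 * ((d : ℝ) + 1) ^ 2 ≤ C₂) (hcB9 : 0 < cB9) (hBbd : 0 ≤ Bbd) (hBd : 4 * Bbd ≤ ((d : ℝ) * L - 1) * inp.B₀)
    (β : ℝ) (len : Site d → ℝ)
    (H4 : B8.Thm4Printed (5 * (d : ℝ) * L * inp.B₀)
      (fun i : {i : ZdIdx d L // ∃ (a : Site d) (M ρ : ℕ), L ≤ ρ ∧ ρ ≤ M ∧ 11 * d < M ∧ L ≤ d * M ∧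
        i.Ω = cubeFam false L a M ρ i.k ∧ i.Λs = cubeLamS L a M ρ i.k ∧ i.Λb = cubeLamB L a M ρ i.k} => (zdGF3 𝔸 L β len i.1).toGFData)) :
    ∃ c₁ : ℝ, 0 < c₁ ∧ ∀ {ι : Type} (f : ι → ZdIdx d L),
      (∀ (jf : ι) (c : CubeB8 d L (f jf).k (f jf).Ω),
      (∀ α₀ α₂ : ℝ, 0 < α₀ → α₀ ≤ cB9 → 0 < α₂ → α₂ ≤ cB9 →
      ∀ (U₀ W : Site d → Fin d → 𝔸ˣ), (∀ x κ, U₀ x κ ∈ unitaryUnits 𝔸) → (∀ x κ, W x κ ∈ unitaryUnits 𝔸) →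
      InAk L c.k (f jf).η α₀ (cubeFam false L c.a c.M c.ρ c.k) U₀ → InAk L c.k (f jf).η α₀ (cubeFam false L c.a c.M c.ρ c.k) (mulCfg W U₀) → IsLandau138W L c.k (f jf).η ((cubeFam false L c.a c.M c.ρ c.k) 0) (cubeLamS L c.a c.M c.ρ c.k c.k) U₀ W →
      ∀ A' : Site d → Fin d → 𝔸, (∀ y τ, IsSelfAdjoint (A' y τ)) →
      (∀ j, j ≤ c.k → ∀ (y : Site d) (τ : Fin d), SideTouches ((cubeFam false L c.a c.M c.ρ c.k) j) y τ →
      W y τ = cfgExp (f jf).η A' y τ ∧ ‖A' y τ‖ ≤ α₂ * ((L : ℝ) ^ j * (f jf).η)⁻¹) →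
      (∀ (y : Site d) (τ : Fin d), (∀ j, j ≤ c.k → ¬ SideTouches ((cubeFam false L c.a c.M c.ρ c.k) j) y τ) → A' y τ = 0) →
      msup L c.k (f jf).η (-(1 : ℝ)) (fun j (b : Site d × Fin d) => SideTouches ((cubeFam false L c.a c.M c.ρ c.k) j) b.1 b.2) (fun b => A' b.1 b.2)
      ≤ inp.B₀ * (bondNorm L c.k (f jf).η (-(3 : ℝ)) (cubeFam false L c.a c.M c.ρ c.k) (fun x μ => Jcur (f jf).η U₀ A' μ x)
      + wsup 1 (fun p : {p : ℕ × (Site d × Fin d) // p.1 ≤ c.k ∧ p.2 ∈ cubeLamB L c.a c.M c.ρ c.k c.k p.1} =>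
      linCovIter L U₀ (iEta (f jf).η A') p.1.1 p.1.2.1 p.1.2.2)) + Bbd * msup L c.k (f jf).η (-(1 : ℝ))
      (fun j (b : Site d × Fin d) => j = 0 ∧ SideTouches ((cubeFam false L c.a c.M c.ρ c.k) 0) b.1 b.2 ∧ ¬ BondTouches ((cubeFam false L c.a c.M c.ρ c.k) 0) b.1 b.2)
      (fun b => A' b.1 b.2) ∧
      msup L c.k (f jf).η (-(2 : ℝ)) (fun j (t : Fin d × Fin d × Site d) => SideTouches ((cubeFam false L c.a c.M c.ρ c.k) j) t.2.2 t.2.1)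
      (fun t => covDerivFwd (f jf).η U₀ t.1 (fun z => A' z t.2.1) t.2.2)
      ≤ inp.B₀ * (bondNorm L c.k (f jf).η (-(3 : ℝ)) (cubeFam false L c.a c.M c.ρ c.k) (fun x μ => Jcur (f jf).η U₀ A' μ x)
      + wsup 1 (fun p : {p : ℕ × (Site d × Fin d) // p.1 ≤ c.k ∧ p.2 ∈ cubeLamB L c.a c.M c.ρ c.k c.k p.1} =>
      linCovIter L U₀ (iEta (f jf).η A') p.1.1 p.1.2.1 p.1.2.2)) + Bbd * msup L c.k (f jf).η (-(1 : ℝ))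
      (fun j (b : Site d × Fin d) => j = 0 ∧ SideTouches ((cubeFam false L c.a c.M c.ρ c.k) 0) b.1 b.2 ∧ ¬ BondTouches ((cubeFam false L c.a c.M c.ρ c.k) 0) b.1 b.2)
      (fun b => A' b.1 b.2) ∧
      bondNorm L c.k (f jf).η (-(3 : ℝ)) (cubeFam false L c.a c.M c.ρ c.k) (fun x μ => pdiv (f jf).η U₀ (plaqCovDeriv (f jf).η U₀ A') μ x)
      ≤ inp.B₀ * (bondNorm L c.k (f jf).η (-(3 : ℝ)) (cubeFam false L c.a c.M c.ρ c.k) (fun x μ => Jcur (f jf).η U₀ A' μ x)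
      + wsup 1 (fun p : {p : ℕ × (Site d × Fin d) // p.1 ≤ c.k ∧ p.2 ∈ cubeLamB L c.a c.M c.ρ c.k c.k p.1} =>
      linCovIter L U₀ (iEta (f jf).η A') p.1.1 p.1.2.1 p.1.2.2)) + Bbd * msup L c.k (f jf).η (-(1 : ℝ))
      (fun j (b : Site d × Fin d) => j = 0 ∧ SideTouches ((cubeFam false L c.a c.M c.ρ c.k) 0) b.1 b.2 ∧ ¬ BondTouches ((cubeFam false L c.a c.M c.ρ c.k) 0) b.1 b.2)
      (fun b => A' b.1 b.2) ∧
      bondNorm L c.k (f jf).η (-(3 : ℝ)) (cubeFam false L c.a c.M c.ρ c.k) (fun x μ => covLap (f jf).η U₀ (fun z => A' z μ) x)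
      ≤ inp.B₀ * (bondNorm L c.k (f jf).η (-(3 : ℝ)) (cubeFam false L c.a c.M c.ρ c.k) (fun x μ => Jcur (f jf).η U₀ A' μ x)
      + wsup 1 (fun p : {p : ℕ × (Site d × Fin d) // p.1 ≤ c.k ∧ p.2 ∈ cubeLamB L c.a c.M c.ρ c.k c.k p.1} =>
      linCovIter L U₀ (iEta (f jf).η A') p.1.1 p.1.2.1 p.1.2.2)) + Bbd * msup L c.k (f jf).η (-(1 : ℝ))
      (fun j (b : Site d × Fin d) => j = 0 ∧ SideTouches ((cubeFam false L c.a c.M c.ρ c.k) 0) b.1 b.2 ∧ ¬ BondTouches ((cubeFam false L c.a c.M c.ρ c.k) 0) b.1 b.2)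
      (fun b => A' b.1 b.2) ∧
      msup L c.k (f jf).η (-(2 + β)) (fun j (q : Fin d × Fin d × (Site d × Site d)) => q.2.2 ∈ AdmPair (f jf).η len ∧ q.2.2.1 ∈ (cubeFam false L c.a c.M c.ρ c.k) j)
      (fun q => hquot (f jf).η β len U₀ (covDerivFwd (f jf).η U₀ q.1 (fun z => A' z q.2.1)) q.2.2)
      ≤ B₀β * (bondNorm L c.k (f jf).η (-(3 : ℝ)) (cubeFam false L c.a c.M c.ρ c.k) (fun x μ => Jcur (f jf).η U₀ A' μ x)
      + wsup 1 (fun p : {p : ℕ × (Site d × Fin d) // p.1 ≤ c.k ∧ p.2 ∈ cubeLamB L c.a c.M c.ρ c.k c.k p.1} =>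
      linCovIter L U₀ (iEta (f jf).η A') p.1.1 p.1.2.1 p.1.2.2)) + Bbd * msup L c.k (f jf).η (-(1 : ℝ))
      (fun j (b : Site d × Fin d) => j = 0 ∧ SideTouches ((cubeFam false L c.a c.M c.ρ c.k) 0) b.1 b.2 ∧ ¬ BondTouches ((cubeFam false L c.a c.M c.ρ c.k) 0) b.1 b.2)
      (fun b => A' b.1 b.2))) →
      B8.Prop6Printed d (L : ℝ) (5 * (d : ℝ) * L * inp.B₀) c₁ (fun j => zdCub 𝔸 L (f j)) := by
  obtain ⟨c₁, hc₁, G⟩ := gaugedBoundB8_cubeMember_of_thm4_b9D (𝔸 := 𝔸) hd2 hL inp hC₂ hcB9 hBbd hBd β len H4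
  refine ⟨c₁, hc₁, fun f S => ?_⟩
  rw [prop6Printed_zdCub_iff]
  intro j α₀ hα U₀ hInA c hs
  exact G (f j).η (f j).hη c (S j c) U₀.1 U₀.2 α₀ hα hInA hs

/-- **`B8.Prop6Printed` ON `Node00.zdCub` FROM THE FIVE SOCKETS IN THE REPAIRED CURRENCY** — the NON-VACUOUS twin of this seat's g0
`B8Prop6CubeMemberGauged.prop6Printed_zdCub₃`: Proposition 5 ∃ base ∕ ∃ step ∕ uniqueness and the (1.59) socket of Theorem 4's frame WITH
exterior data at every member of the cube sub-family (`B8LeafModelZd3Bdry.thm4Printed_zd3_map_bdry` serves `H4`), and the Prop.-3-frame b9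
socket WITH exterior data at every cube.  None of the five binders is certified false (rows 126∕131∕135 concern the un-repaired currency).
[cite: Balaban1985RegularSpaces, Prop. 6 p.99, Thm 4 p.88, Prop. 3 p.87, Prop. 5 (1.107)–(1.109) p.94, (1.59) p.86] -/
theorem prop6Printed_zdCub_bdry₅ (hd2 : 2 ≤ d) {L : ℕ} (hL : 2 ≤ L) (inp : B8.B9Inputs) {B₀β C₂ cB9 cu cP Bbd : ℝ}
    (hB : 2 ≤ 5 * (d : ℝ) * L * inp.B₀) (hC₂ : 2097152 * ((d : ℝ) + 1) ^ 2 ≤ C₂) (hcB9 : 0 < cB9) (hcu : 0 < cu) (hcP : 0 < cP)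
    (hBbd : 0 ≤ Bbd) (hBd : 4 * Bbd ≤ ((d : ℝ) * L - 1) * inp.B₀) (β : ℝ) (len : Site d → ℝ)
    (SP5base : ∀ i : {i : ZdIdx d L // ∃ (a : Site d) (M ρ : ℕ), L ≤ ρ ∧ ρ ≤ M ∧ 11 * d < M ∧ L ≤ d * M ∧
        i.Ω = cubeFam false L a M ρ i.k ∧ i.Λs = cubeLamS L a M ρ i.k ∧ i.Λb = cubeLamB L a M ρ i.k}, SockP5base (𝔸 := 𝔸) L inp.B₀ inp.B₀' cP i.1.η i.1.k i.1.Ω i.1.Λs)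
    (SP5 : ∀ i : {i : ZdIdx d L // ∃ (a : Site d) (M ρ : ℕ), L ≤ ρ ∧ ρ ≤ M ∧ 11 * d < M ∧ L ≤ d * M ∧
        i.Ω = cubeFam false L a M ρ i.k ∧ i.Λs = cubeLamS L a M ρ i.k ∧ i.Λb = cubeLamB L a M ρ i.k}, SockP5 (𝔸 := 𝔸) L inp.B₀ inp.B₀' cP i.1.η i.1.k i.1.Ω i.1.Λs)
    (SH59D : ∀ i : {i : ZdIdx d L // ∃ (a : Site d) (M ρ : ℕ), L ≤ ρ ∧ ρ ≤ M ∧ 11 * d < M ∧ L ≤ d * M ∧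
        i.Ω = cubeFam false L a M ρ i.k ∧ i.Λs = cubeLamS L a M ρ i.k ∧ i.Λb = cubeLamB L a M ρ i.k},
      (∀ α₀ α₁ : ℝ, 0 < α₀ → 0 < α₁ → α₀ + α₁ ≤ cP →
        ∀ U₀ U' : Site d → Fin d → 𝔸ˣ, (∀ x κ, U₀ x κ ∈ unitaryUnits 𝔸) → (∀ x κ, U' x κ ∈ unitaryUnits 𝔸) →
        InAk L i.1.k i.1.η α₀ i.1.Ω U₀ → InAk L i.1.k i.1.η α₀ i.1.Ω (mulCfg U' U₀) → (∀ m, m ≤ i.1.k → InAx L m (i.1.Λs m) U₀ (mulCfg U' U₀)) →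
        (∀ j, j ≤ i.1.k → ∀ (z : Site d) (μ : Fin d), (∀ x, InBox (loK L j z) (bondHiK L j z μ) x → x ∈ i.1.Ω j) →
          ‖(avgIter L (mulCfg U' U₀) j z μ : 𝔸) - (avgIter L U₀ j z μ : 𝔸)‖ ≤ α₁) →
        (∀ b ∈ {b : Site d × Fin d | SideTouches (i.1.Ω 0) b.1 b.2}, ‖((U' b.1 b.2 : 𝔸ˣ) : 𝔸) - 1‖ ≤ α₁) →
        (∀ m, 1 ≤ m → m ≤ i.1.k → ∀ (u : Site d → 𝔸ˣ) (W : Site d → Fin d → 𝔸ˣ) (A' : Site d → Fin d → 𝔸),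
          (∀ x, u x ∈ unitaryUnits 𝔸) → (∀ x, x ∉ i.1.Ω 0 → u x = 1) → mgauge U₀ u W = U' → Restr129 L m (i.1.Λs m) U₀ u →
          IsLandau138W L m i.1.η (i.1.Ω 0) (i.1.Λs m) U₀ W → (∀ y τ, IsSelfAdjoint (A' y τ)) →
          (∀ j, j ≤ m → ∀ y τ, SideTouches (i.1.Ω j) y τ →
          W y τ = cfgExp i.1.η A' y τ ∧ ‖A' y τ‖ ≤ (2 * (L * (5 * (d : ℝ) * L * inp.B₀ * (α₀ + α₁))) + 8 * (8 * inp.B₀' * (5 * (d : ℝ) * L * inp.B₀) * (α₀ + α₁))) * ((L : ℝ) ^ j * i.1.η)⁻¹) →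
          (∀ y τ, (∀ j, j ≤ m → ¬ SideTouches (i.1.Ω j) y τ) → A' y τ = 0) →
          msup L m i.1.η (-(1 : ℝ)) (fun j (b : Site d × Fin d) => SideTouches (i.1.Ω j) b.1 b.2) (fun b => A' b.1 b.2)
          ≤ inp.B₀ * (bondNorm L m i.1.η (-(3 : ℝ)) i.1.Ω (fun x μ => Jcur i.1.η U₀ A' μ x)
          + wsup 1 (fun p : {p : ℕ × (Site d × Fin d) // p.1 ≤ m ∧ p.2 ∈ i.1.Λb m p.1} =>
          linCovIter L U₀ (iEta i.1.η A') p.1.1 p.1.2.1 p.1.2.2))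
          + Bbd * msup L m i.1.η (-(1 : ℝ)) (fun j (b : Site d × Fin d) => j = 0 ∧ SideTouches (i.1.Ω 0) b.1 b.2 ∧ ¬ BondTouches (i.1.Ω 0) b.1 b.2)
              (fun b => A' b.1 b.2) ∧
          msup L m i.1.η (-(2 : ℝ)) (fun j (t : Fin d × Fin d × Site d) => SideTouches (i.1.Ω j) t.2.2 t.2.1)
          (fun t => covDerivFwd i.1.η U₀ t.1 (fun z => A' z t.2.1) t.2.2)
          ≤ inp.B₀ * (bondNorm L m i.1.η (-(3 : ℝ)) i.1.Ω (fun x μ => Jcur i.1.η U₀ A' μ x)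
          + wsup 1 (fun p : {p : ℕ × (Site d × Fin d) // p.1 ≤ m ∧ p.2 ∈ i.1.Λb m p.1} =>
          linCovIter L U₀ (iEta i.1.η A') p.1.1 p.1.2.1 p.1.2.2))
          + Bbd * msup L m i.1.η (-(1 : ℝ)) (fun j (b : Site d × Fin d) => j = 0 ∧ SideTouches (i.1.Ω 0) b.1 b.2 ∧ ¬ BondTouches (i.1.Ω 0) b.1 b.2)
              (fun b => A' b.1 b.2))))
    (SP5u : ∀ i : {i : ZdIdx d L // ∃ (a : Site d) (M ρ : ℕ), L ≤ ρ ∧ ρ ≤ M ∧ 11 * d < M ∧ L ≤ d * M ∧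
        i.Ω = cubeFam false L a M ρ i.k ∧ i.Λs = cubeLamS L a M ρ i.k ∧ i.Λb = cubeLamB L a M ρ i.k}, SockP5u (𝔸 := 𝔸) L cP cu i.1.η i.1.k i.1.Ω i.1.Λs) :
    ∃ c₁ : ℝ, 0 < c₁ ∧ ∀ {ι : Type} (f : ι → ZdIdx d L),
      (∀ (jf : ι) (c : CubeB8 d L (f jf).k (f jf).Ω),
      (∀ α₀ α₂ : ℝ, 0 < α₀ → α₀ ≤ cB9 → 0 < α₂ → α₂ ≤ cB9 →
      ∀ (U₀ W : Site d → Fin d → 𝔸ˣ), (∀ x κ, U₀ x κ ∈ unitaryUnits 𝔸) → (∀ x κ, W x κ ∈ unitaryUnits 𝔸) →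
      InAk L c.k (f jf).η α₀ (cubeFam false L c.a c.M c.ρ c.k) U₀ → InAk L c.k (f jf).η α₀ (cubeFam false L c.a c.M c.ρ c.k) (mulCfg W U₀) → IsLandau138W L c.k (f jf).η ((cubeFam false L c.a c.M c.ρ c.k) 0) (cubeLamS L c.a c.M c.ρ c.k c.k) U₀ W →
      ∀ A' : Site d → Fin d → 𝔸, (∀ y τ, IsSelfAdjoint (A' y τ)) →
      (∀ j, j ≤ c.k → ∀ (y : Site d) (τ : Fin d), SideTouches ((cubeFam false L c.a c.M c.ρ c.k) j) y τ →
      W y τ = cfgExp (f jf).η A' y τ ∧ ‖A' y τ‖ ≤ α₂ * ((L : ℝ) ^ j * (f jf).η)⁻¹) →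
      (∀ (y : Site d) (τ : Fin d), (∀ j, j ≤ c.k → ¬ SideTouches ((cubeFam false L c.a c.M c.ρ c.k) j) y τ) → A' y τ = 0) →
      msup L c.k (f jf).η (-(1 : ℝ)) (fun j (b : Site d × Fin d) => SideTouches ((cubeFam false L c.a c.M c.ρ c.k) j) b.1 b.2) (fun b => A' b.1 b.2)
      ≤ inp.B₀ * (bondNorm L c.k (f jf).η (-(3 : ℝ)) (cubeFam false L c.a c.M c.ρ c.k) (fun x μ => Jcur (f jf).η U₀ A' μ x)
      + wsup 1 (fun p : {p : ℕ × (Site d × Fin d) // p.1 ≤ c.k ∧ p.2 ∈ cubeLamB L c.a c.M c.ρ c.k c.k p.1} =>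
      linCovIter L U₀ (iEta (f jf).η A') p.1.1 p.1.2.1 p.1.2.2)) + Bbd * msup L c.k (f jf).η (-(1 : ℝ))
      (fun j (b : Site d × Fin d) => j = 0 ∧ SideTouches ((cubeFam false L c.a c.M c.ρ c.k) 0) b.1 b.2 ∧ ¬ BondTouches ((cubeFam false L c.a c.M c.ρ c.k) 0) b.1 b.2)
      (fun b => A' b.1 b.2) ∧
      msup L c.k (f jf).η (-(2 : ℝ)) (fun j (t : Fin d × Fin d × Site d) => SideTouches ((cubeFam false L c.a c.M c.ρ c.k) j) t.2.2 t.2.1)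
      (fun t => covDerivFwd (f jf).η U₀ t.1 (fun z => A' z t.2.1) t.2.2)
      ≤ inp.B₀ * (bondNorm L c.k (f jf).η (-(3 : ℝ)) (cubeFam false L c.a c.M c.ρ c.k) (fun x μ => Jcur (f jf).η U₀ A' μ x)
      + wsup 1 (fun p : {p : ℕ × (Site d × Fin d) // p.1 ≤ c.k ∧ p.2 ∈ cubeLamB L c.a c.M c.ρ c.k c.k p.1} =>
      linCovIter L U₀ (iEta (f jf).η A') p.1.1 p.1.2.1 p.1.2.2)) + Bbd * msup L c.k (f jf).η (-(1 : ℝ))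
      (fun j (b : Site d × Fin d) => j = 0 ∧ SideTouches ((cubeFam false L c.a c.M c.ρ c.k) 0) b.1 b.2 ∧ ¬ BondTouches ((cubeFam false L c.a c.M c.ρ c.k) 0) b.1 b.2)
      (fun b => A' b.1 b.2) ∧
      bondNorm L c.k (f jf).η (-(3 : ℝ)) (cubeFam false L c.a c.M c.ρ c.k) (fun x μ => pdiv (f jf).η U₀ (plaqCovDeriv (f jf).η U₀ A') μ x)
      ≤ inp.B₀ * (bondNorm L c.k (f jf).η (-(3 : ℝ)) (cubeFam false L c.a c.M c.ρ c.k) (fun x μ => Jcur (f jf).η U₀ A' μ x)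
      + wsup 1 (fun p : {p : ℕ × (Site d × Fin d) // p.1 ≤ c.k ∧ p.2 ∈ cubeLamB L c.a c.M c.ρ c.k c.k p.1} =>
      linCovIter L U₀ (iEta (f jf).η A') p.1.1 p.1.2.1 p.1.2.2)) + Bbd * msup L c.k (f jf).η (-(1 : ℝ))
      (fun j (b : Site d × Fin d) => j = 0 ∧ SideTouches ((cubeFam false L c.a c.M c.ρ c.k) 0) b.1 b.2 ∧ ¬ BondTouches ((cubeFam false L c.a c.M c.ρ c.k) 0) b.1 b.2)
      (fun b => A' b.1 b.2) ∧
      bondNorm L c.k (f jf).η (-(3 : ℝ)) (cubeFam false L c.a c.M c.ρ c.k) (fun x μ => covLap (f jf).η U₀ (fun z => A' z μ) x)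
      ≤ inp.B₀ * (bondNorm L c.k (f jf).η (-(3 : ℝ)) (cubeFam false L c.a c.M c.ρ c.k) (fun x μ => Jcur (f jf).η U₀ A' μ x)
      + wsup 1 (fun p : {p : ℕ × (Site d × Fin d) // p.1 ≤ c.k ∧ p.2 ∈ cubeLamB L c.a c.M c.ρ c.k c.k p.1} =>
      linCovIter L U₀ (iEta (f jf).η A') p.1.1 p.1.2.1 p.1.2.2)) + Bbd * msup L c.k (f jf).η (-(1 : ℝ))
      (fun j (b : Site d × Fin d) => j = 0 ∧ SideTouches ((cubeFam false L c.a c.M c.ρ c.k) 0) b.1 b.2 ∧ ¬ BondTouches ((cubeFam false L c.a c.M c.ρ c.k) 0) b.1 b.2)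
      (fun b => A' b.1 b.2) ∧
      msup L c.k (f jf).η (-(2 + β)) (fun j (q : Fin d × Fin d × (Site d × Site d)) => q.2.2 ∈ AdmPair (f jf).η len ∧ q.2.2.1 ∈ (cubeFam false L c.a c.M c.ρ c.k) j)
      (fun q => hquot (f jf).η β len U₀ (covDerivFwd (f jf).η U₀ q.1 (fun z => A' z q.2.1)) q.2.2)
      ≤ B₀β * (bondNorm L c.k (f jf).η (-(3 : ℝ)) (cubeFam false L c.a c.M c.ρ c.k) (fun x μ => Jcur (f jf).η U₀ A' μ x)
      + wsup 1 (fun p : {p : ℕ × (Site d × Fin d) // p.1 ≤ c.k ∧ p.2 ∈ cubeLamB L c.a c.M c.ρ c.k c.k p.1} =>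
      linCovIter L U₀ (iEta (f jf).η A') p.1.1 p.1.2.1 p.1.2.2)) + Bbd * msup L c.k (f jf).η (-(1 : ℝ))
      (fun j (b : Site d × Fin d) => j = 0 ∧ SideTouches ((cubeFam false L c.a c.M c.ρ c.k) 0) b.1 b.2 ∧ ¬ BondTouches ((cubeFam false L c.a c.M c.ρ c.k) 0) b.1 b.2)
      (fun b => A' b.1 b.2))) →
      B8.Prop6Printed d (L : ℝ) (5 * (d : ℝ) * L * inp.B₀) c₁ (fun j => zdCub 𝔸 L (f j)) :=
  prop6Printed_zdCub_of_thm4_b9D (𝔸 := 𝔸) hd2 hL inp hC₂ hcB9 hBbd hBd β len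
    (B8LeafModelZd3Bdry.thm4Printed_zd3_map_bdry (𝔸 := 𝔸) hd2 hL inp.B₀_pos inp.B₀'_pos hB hcu hcP hBbd hBd
      (Subtype.val : {i : ZdIdx d L // ∃ (a : Site d) (M ρ : ℕ), L ≤ ρ ∧ ρ ≤ M ∧ 11 * d < M ∧ L ≤ d * M ∧
        i.Ω = cubeFam false L a M ρ i.k ∧ i.Λs = cubeLamS L a M ρ i.k ∧ i.Λb = cubeLamB L a M ρ i.k} → ZdIdx d L)
      SP5base SP5 SH59D SP5u)

#print axioms prop6Printed_zdCub_of_thm4_b9D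
#print axioms prop6Printed_zdCub_bdry₅

/-- **`B8.Prop6Printed` ON NODE 00's MEMBER OF RECORD `Node00.cubB8OfRecord θ` FROM THE FIVE SOCKETS IN THE REPAIRED CURRENCY** — the
NON-VACUOUS twin of this seat's g0 `prop6Printed_cubB8OfRecord₃` (the `p6` letter of the record knits at `ResidB8.withCub`):
`prop6Printed_zdCub_bdry₅` at `f := Subtype.val`. [cite: Balaban1985RegularSpaces, Prop. 6 p.99, Thm 4 p.88, Prop. 3 p.87, Prop. 5 p.94, (1.59) p.86] -/
theorem prop6Printed_cubB8OfRecord_bdry₅ (θ : Node00.Stage3Params) (hD : 2 ≤ θ.D) (inp : B8.B9Inputs) {B₀β C₂ cB9 cu cP Bbd : ℝ}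
    (hB : 2 ≤ 5 * (θ.D : ℝ) * θ.L * inp.B₀) (hC₂ : 2097152 * ((θ.D : ℝ) + 1) ^ 2 ≤ C₂) (hcB9 : 0 < cB9) (hcu : 0 < cu) (hcP : 0 < cP)
    (hBbd : 0 ≤ Bbd) (hBd : 4 * Bbd ≤ ((θ.D : ℝ) * θ.L - 1) * inp.B₀) (β : ℝ) (len : Site θ.D → ℝ)
    (SP5base : ∀ i : {i : ZdIdx θ.D θ.L // ∃ (a : Site θ.D) (M ρ : ℕ), θ.L ≤ ρ ∧ ρ ≤ M ∧ 11 * θ.D < M ∧ θ.L ≤ θ.D * M ∧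
        i.Ω = cubeFam false θ.L a M ρ i.k ∧ i.Λs = cubeLamS θ.L a M ρ i.k ∧ i.Λb = cubeLamB θ.L a M ρ i.k}, SockP5base (𝔸 := θ.𝔸) θ.L inp.B₀ inp.B₀' cP i.1.η i.1.k i.1.Ω i.1.Λs)
    (SP5 : ∀ i : {i : ZdIdx θ.D θ.L // ∃ (a : Site θ.D) (M ρ : ℕ), θ.L ≤ ρ ∧ ρ ≤ M ∧ 11 * θ.D < M ∧ θ.L ≤ θ.D * M ∧
        i.Ω = cubeFam false θ.L a M ρ i.k ∧ i.Λs = cubeLamS θ.L a M ρ i.k ∧ i.Λb = cubeLamB θ.L a M ρ i.k}, SockP5 (𝔸 := θ.𝔸) θ.L inp.B₀ inp.B₀' cP i.1.η i.1.k i.1.Ω i.1.Λs)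
    (SH59D : ∀ i : {i : ZdIdx θ.D θ.L // ∃ (a : Site θ.D) (M ρ : ℕ), θ.L ≤ ρ ∧ ρ ≤ M ∧ 11 * θ.D < M ∧ θ.L ≤ θ.D * M ∧
        i.Ω = cubeFam false θ.L a M ρ i.k ∧ i.Λs = cubeLamS θ.L a M ρ i.k ∧ i.Λb = cubeLamB θ.L a M ρ i.k},
      (∀ α₀ α₁ : ℝ, 0 < α₀ → 0 < α₁ → α₀ + α₁ ≤ cP →
        ∀ U₀ U' : Site θ.D → Fin θ.D → θ.𝔸ˣ, (∀ x κ, U₀ x κ ∈ unitaryUnits θ.𝔸) → (∀ x κ, U' x κ ∈ unitaryUnits θ.𝔸) →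
        InAk θ.L i.1.k i.1.η α₀ i.1.Ω U₀ → InAk θ.L i.1.k i.1.η α₀ i.1.Ω (mulCfg U' U₀) → (∀ m, m ≤ i.1.k → InAx θ.L m (i.1.Λs m) U₀ (mulCfg U' U₀)) →
        (∀ j, j ≤ i.1.k → ∀ (z : Site θ.D) (μ : Fin θ.D), (∀ x, InBox (loK θ.L j z) (bondHiK θ.L j z μ) x → x ∈ i.1.Ω j) →
          ‖(avgIter θ.L (mulCfg U' U₀) j z μ : θ.𝔸) - (avgIter θ.L U₀ j z μ : θ.𝔸)‖ ≤ α₁) →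
        (∀ b ∈ {b : Site θ.D × Fin θ.D | SideTouches (i.1.Ω 0) b.1 b.2}, ‖((U' b.1 b.2 : θ.𝔸ˣ) : θ.𝔸) - 1‖ ≤ α₁) →
        (∀ m, 1 ≤ m → m ≤ i.1.k → ∀ (u : Site θ.D → θ.𝔸ˣ) (W : Site θ.D → Fin θ.D → θ.𝔸ˣ) (A' : Site θ.D → Fin θ.D → θ.𝔸),
          (∀ x, u x ∈ unitaryUnits θ.𝔸) → (∀ x, x ∉ i.1.Ω 0 → u x = 1) → mgauge U₀ u W = U' → Restr129 θ.L m (i.1.Λs m) U₀ u →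
          IsLandau138W θ.L m i.1.η (i.1.Ω 0) (i.1.Λs m) U₀ W → (∀ y τ, IsSelfAdjoint (A' y τ)) →
          (∀ j, j ≤ m → ∀ y τ, SideTouches (i.1.Ω j) y τ →
          W y τ = cfgExp i.1.η A' y τ ∧ ‖A' y τ‖ ≤ (2 * (θ.L * (5 * (θ.D : ℝ) * θ.L * inp.B₀ * (α₀ + α₁))) + 8 * (8 * inp.B₀' * (5 * (θ.D : ℝ) * θ.L * inp.B₀) * (α₀ + α₁))) * ((θ.L : ℝ) ^ j * i.1.η)⁻¹) →
          (∀ y τ, (∀ j, j ≤ m → ¬ SideTouches (i.1.Ω j) y τ) → A' y τ = 0) →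
          msup θ.L m i.1.η (-(1 : ℝ)) (fun j (b : Site θ.D × Fin θ.D) => SideTouches (i.1.Ω j) b.1 b.2) (fun b => A' b.1 b.2)
          ≤ inp.B₀ * (bondNorm θ.L m i.1.η (-(3 : ℝ)) i.1.Ω (fun x μ => Jcur i.1.η U₀ A' μ x)
          + wsup 1 (fun p : {p : ℕ × (Site θ.D × Fin θ.D) // p.1 ≤ m ∧ p.2 ∈ i.1.Λb m p.1} =>
          linCovIter θ.L U₀ (iEta i.1.η A') p.1.1 p.1.2.1 p.1.2.2))
          + Bbd * msup θ.L m i.1.η (-(1 : ℝ)) (fun j (b : Site θ.D × Fin θ.D) => j = 0 ∧ SideTouches (i.1.Ω 0) b.1 b.2 ∧ ¬ BondTouches (i.1.Ω 0) b.1 b.2)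
              (fun b => A' b.1 b.2) ∧
          msup θ.L m i.1.η (-(2 : ℝ)) (fun j (t : Fin θ.D × Fin θ.D × Site θ.D) => SideTouches (i.1.Ω j) t.2.2 t.2.1)
          (fun t => covDerivFwd i.1.η U₀ t.1 (fun z => A' z t.2.1) t.2.2)
          ≤ inp.B₀ * (bondNorm θ.L m i.1.η (-(3 : ℝ)) i.1.Ω (fun x μ => Jcur i.1.η U₀ A' μ x)
          + wsup 1 (fun p : {p : ℕ × (Site θ.D × Fin θ.D) // p.1 ≤ m ∧ p.2 ∈ i.1.Λb m p.1} =>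
          linCovIter θ.L U₀ (iEta i.1.η A') p.1.1 p.1.2.1 p.1.2.2))
          + Bbd * msup θ.L m i.1.η (-(1 : ℝ)) (fun j (b : Site θ.D × Fin θ.D) => j = 0 ∧ SideTouches (i.1.Ω 0) b.1 b.2 ∧ ¬ BondTouches (i.1.Ω 0) b.1 b.2)
              (fun b => A' b.1 b.2))))
    (SP5u : ∀ i : {i : ZdIdx θ.D θ.L // ∃ (a : Site θ.D) (M ρ : ℕ), θ.L ≤ ρ ∧ ρ ≤ M ∧ 11 * θ.D < M ∧ θ.L ≤ θ.D * M ∧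
        i.Ω = cubeFam false θ.L a M ρ i.k ∧ i.Λs = cubeLamS θ.L a M ρ i.k ∧ i.Λb = cubeLamB θ.L a M ρ i.k}, SockP5u (𝔸 := θ.𝔸) θ.L cP cu i.1.η i.1.k i.1.Ω i.1.Λs) :
    ∃ c₁ : ℝ, 0 < c₁ ∧
      ((∀ (jf : Node00.IdxB8 θ) (c : CubeB8 θ.D θ.L jf.1.k jf.1.Ω),
      (∀ α₀ α₂ : ℝ, 0 < α₀ → α₀ ≤ cB9 → 0 < α₂ → α₂ ≤ cB9 →
      ∀ (U₀ W : Site θ.D → Fin θ.D → θ.𝔸ˣ), (∀ x κ, U₀ x κ ∈ unitaryUnits θ.𝔸) → (∀ x κ, W x κ ∈ unitaryUnits θ.𝔸) →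
      InAk θ.L c.k jf.1.η α₀ (cubeFam false θ.L c.a c.M c.ρ c.k) U₀ → InAk θ.L c.k jf.1.η α₀ (cubeFam false θ.L c.a c.M c.ρ c.k) (mulCfg W U₀) → IsLandau138W θ.L c.k jf.1.η ((cubeFam false θ.L c.a c.M c.ρ c.k) 0) (cubeLamS θ.L c.a c.M c.ρ c.k c.k) U₀ W →
      ∀ A' : Site θ.D → Fin θ.D → θ.𝔸, (∀ y τ, IsSelfAdjoint (A' y τ)) →
      (∀ j, j ≤ c.k → ∀ (y : Site θ.D) (τ : Fin θ.D), SideTouches ((cubeFam false θ.L c.a c.M c.ρ c.k) j) y τ →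
      W y τ = cfgExp jf.1.η A' y τ ∧ ‖A' y τ‖ ≤ α₂ * ((θ.L : ℝ) ^ j * jf.1.η)⁻¹) →
      (∀ (y : Site θ.D) (τ : Fin θ.D), (∀ j, j ≤ c.k → ¬ SideTouches ((cubeFam false θ.L c.a c.M c.ρ c.k) j) y τ) → A' y τ = 0) →
      msup θ.L c.k jf.1.η (-(1 : ℝ)) (fun j (b : Site θ.D × Fin θ.D) => SideTouches ((cubeFam false θ.L c.a c.M c.ρ c.k) j) b.1 b.2) (fun b => A' b.1 b.2)
      ≤ inp.B₀ * (bondNorm θ.L c.k jf.1.η (-(3 : ℝ)) (cubeFam false θ.L c.a c.M c.ρ c.k) (fun x μ => Jcur jf.1.η U₀ A' μ x)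
      + wsup 1 (fun p : {p : ℕ × (Site θ.D × Fin θ.D) // p.1 ≤ c.k ∧ p.2 ∈ cubeLamB θ.L c.a c.M c.ρ c.k c.k p.1} =>
      linCovIter θ.L U₀ (iEta jf.1.η A') p.1.1 p.1.2.1 p.1.2.2)) + Bbd * msup θ.L c.k jf.1.η (-(1 : ℝ))
      (fun j (b : Site θ.D × Fin θ.D) => j = 0 ∧ SideTouches ((cubeFam false θ.L c.a c.M c.ρ c.k) 0) b.1 b.2 ∧ ¬ BondTouches ((cubeFam false θ.L c.a c.M c.ρ c.k) 0) b.1 b.2)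
      (fun b => A' b.1 b.2) ∧
      msup θ.L c.k jf.1.η (-(2 : ℝ)) (fun j (t : Fin θ.D × Fin θ.D × Site θ.D) => SideTouches ((cubeFam false θ.L c.a c.M c.ρ c.k) j) t.2.2 t.2.1)
      (fun t => covDerivFwd jf.1.η U₀ t.1 (fun z => A' z t.2.1) t.2.2)
      ≤ inp.B₀ * (bondNorm θ.L c.k jf.1.η (-(3 : ℝ)) (cubeFam false θ.L c.a c.M c.ρ c.k) (fun x μ => Jcur jf.1.η U₀ A' μ x)
      + wsup 1 (fun p : {p : ℕ × (Site θ.D × Fin θ.D) // p.1 ≤ c.k ∧ p.2 ∈ cubeLamB θ.L c.a c.M c.ρ c.k c.k p.1} =>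
      linCovIter θ.L U₀ (iEta jf.1.η A') p.1.1 p.1.2.1 p.1.2.2)) + Bbd * msup θ.L c.k jf.1.η (-(1 : ℝ))
      (fun j (b : Site θ.D × Fin θ.D) => j = 0 ∧ SideTouches ((cubeFam false θ.L c.a c.M c.ρ c.k) 0) b.1 b.2 ∧ ¬ BondTouches ((cubeFam false θ.L c.a c.M c.ρ c.k) 0) b.1 b.2)
      (fun b => A' b.1 b.2) ∧
      bondNorm θ.L c.k jf.1.η (-(3 : ℝ)) (cubeFam false θ.L c.a c.M c.ρ c.k) (fun x μ => pdiv jf.1.η U₀ (plaqCovDeriv jf.1.η U₀ A') μ x)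
      ≤ inp.B₀ * (bondNorm θ.L c.k jf.1.η (-(3 : ℝ)) (cubeFam false θ.L c.a c.M c.ρ c.k) (fun x μ => Jcur jf.1.η U₀ A' μ x)
      + wsup 1 (fun p : {p : ℕ × (Site θ.D × Fin θ.D) // p.1 ≤ c.k ∧ p.2 ∈ cubeLamB θ.L c.a c.M c.ρ c.k c.k p.1} =>
      linCovIter θ.L U₀ (iEta jf.1.η A') p.1.1 p.1.2.1 p.1.2.2)) + Bbd * msup θ.L c.k jf.1.η (-(1 : ℝ))
      (fun j (b : Site θ.D × Fin θ.D) => j = 0 ∧ SideTouches ((cubeFam false θ.L c.a c.M c.ρ c.k) 0) b.1 b.2 ∧ ¬ BondTouches ((cubeFam false θ.L c.a c.M c.ρ c.k) 0) b.1 b.2)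
      (fun b => A' b.1 b.2) ∧
      bondNorm θ.L c.k jf.1.η (-(3 : ℝ)) (cubeFam false θ.L c.a c.M c.ρ c.k) (fun x μ => covLap jf.1.η U₀ (fun z => A' z μ) x)
      ≤ inp.B₀ * (bondNorm θ.L c.k jf.1.η (-(3 : ℝ)) (cubeFam false θ.L c.a c.M c.ρ c.k) (fun x μ => Jcur jf.1.η U₀ A' μ x)
      + wsup 1 (fun p : {p : ℕ × (Site θ.D × Fin θ.D) // p.1 ≤ c.k ∧ p.2 ∈ cubeLamB θ.L c.a c.M c.ρ c.k c.k p.1} =>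
      linCovIter θ.L U₀ (iEta jf.1.η A') p.1.1 p.1.2.1 p.1.2.2)) + Bbd * msup θ.L c.k jf.1.η (-(1 : ℝ))
      (fun j (b : Site θ.D × Fin θ.D) => j = 0 ∧ SideTouches ((cubeFam false θ.L c.a c.M c.ρ c.k) 0) b.1 b.2 ∧ ¬ BondTouches ((cubeFam false θ.L c.a c.M c.ρ c.k) 0) b.1 b.2)
      (fun b => A' b.1 b.2) ∧
      msup θ.L c.k jf.1.η (-(2 + β)) (fun j (q : Fin θ.D × Fin θ.D × (Site θ.D × Site θ.D)) => q.2.2 ∈ AdmPair jf.1.η len ∧ q.2.2.1 ∈ (cubeFam false θ.L c.a c.M c.ρ c.k) j)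
      (fun q => hquot jf.1.η β len U₀ (covDerivFwd jf.1.η U₀ q.1 (fun z => A' z q.2.1)) q.2.2)
      ≤ B₀β * (bondNorm θ.L c.k jf.1.η (-(3 : ℝ)) (cubeFam false θ.L c.a c.M c.ρ c.k) (fun x μ => Jcur jf.1.η U₀ A' μ x)
      + wsup 1 (fun p : {p : ℕ × (Site θ.D × Fin θ.D) // p.1 ≤ c.k ∧ p.2 ∈ cubeLamB θ.L c.a c.M c.ρ c.k c.k p.1} =>
      linCovIter θ.L U₀ (iEta jf.1.η A') p.1.1 p.1.2.1 p.1.2.2)) + Bbd * msup θ.L c.k jf.1.η (-(1 : ℝ))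
      (fun j (b : Site θ.D × Fin θ.D) => j = 0 ∧ SideTouches ((cubeFam false θ.L c.a c.M c.ρ c.k) 0) b.1 b.2 ∧ ¬ BondTouches ((cubeFam false θ.L c.a c.M c.ρ c.k) 0) b.1 b.2)
      (fun b => A' b.1 b.2))) →
      B8.Prop6Printed θ.D (θ.L : ℝ) (5 * (θ.D : ℝ) * θ.L * inp.B₀) c₁ (Node00.cubB8OfRecord θ))  := by
  obtain ⟨c₁, hc₁, G⟩ := prop6Printed_zdCub_bdry₅ (𝔸 := θ.𝔸) hD θ.two_le_L inp hB hC₂ hcB9 hcu hcP hBbd hBd β len SP5base SP5 SH59D SP5u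
  exact ⟨c₁, hc₁, fun S => G (fun i : Node00.IdxB8 θ => i.1) S⟩

#print axioms prop6Printed_cubB8OfRecord_bdry₅

end Literature.MathematicalPhysics.QuantumFieldTheory.Balaban1983to89.B8Prop6CubeMemberGaugedBdry

end
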